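import Summits.QuantumFields.YangMills.Theorems.BalabanUVNodesK0AxTangentSocketOnto
import Summits.QuantumFields.YangMills.Theorems.BalabanUVNodesK0Stub1FlatAveragingDictionary
import Summits.QuantumFields.YangMills.Theorems.BalabanUVNodesN12MinimiserFamilyAtRecordBjNoPlaqGuard
import Summits.QuantumFields.YangMills.Theorems.BalabanUVNodesPortU8WindowDomains
import Literature.MathematicalPhysics.QuantumFieldTheory.Balaban1983to89.Node00.WilsonActionSecondVariationNearFlat

/-!
# NODE O · K0ᴬ — (J-crit′) AT THE CANONICAL FLAT LOGARITHMIC CHART IS TRUE: `FlatCritDictionary F k K Ψ₀` DISCHARGED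
# (the junction between DEF-1's K0 quadratic form `⟪dcE 1 ·, dcE 1 ·⟫` on `ξ⁻¹`·re∕im ENTRIES — [B6] Sect. A — and Node00's flat second variation `D²(A∘expChart 1)(0)`, kernel-checked)

Cell `ym-nodeO-ideate`, DEFINER seat ★★ DEF-1 `ym-nodeO-def-1` g38 (prover; count-neutral helper of K0ᴬ `stmt-QuantumFields-27238`, `--kind proof --supports … --as helper`;
INTENT-DEF1-g38-1, nodeO STATUS 2026-08-31T12:24:49Z).  THEOREMS ONLY (0 `def`, 0 `instance`, 0 `notation`, 0 `sorry`; standard axioms).  Asked BY NAME by ◆ CRIT-1 g38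
(nodeO STATUS 12:04:14Z «DEF-1: please state whether (U-6-β)'s `QE (univDomains …)` IS `Q̄_{k+1}(1)` entrywise with these weights») and ◇ `ymgap-nodeO-lens-1` g11 (11:54:21Z «please
price (J-crit′) ∕ (J-cons′) at the concrete chart with DEF-1»).  [15] = [Balaban1985Variational], [B5] = [Balaban1984PropagatorsI], [B6] = [Balaban1984PropagatorsII],
[B7] = [Balaban1985Averaging], [B9] = [Balaban1985BackgroundPropagators].

WHY.  ◇ lens-1's tangent socket (✓`…K0AxTangentSocket` §4, ✓`…K0AxTangentSocketPsi` ∕ `…Onto`) reduces the four ROOTED receipts of the (R-a) road at the canonical flat logarithmic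
chart `Ψ₀ := msChart F 2 K (k+1) (atScale (k+1)) Ū(1) 1` to displayed letters, two of which are FINITE FLAT DICTIONARIES written in DEF-1's K0 vocabulary: (J-crit′)
`FlatCritDictionary F k K Ψ₀` and (J-cons′) `FlatConsDictionary F θ k K Ψ₀ datum`.  The junction both rest on is the tree's FLAT AVERAGING DICTIONARY (k0-s1-w1,
✓`K0Stub1FlatAveragingDictionary.qLin_one_eq_sub_comb`): `DΨ₀(0) = π ∘ qLin (k+1) 1` (the linearised (0.4) CONTOUR average) equals `L^{k+1}·` [B5] (1.18)'s STRAIGHT mean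
`bondAvgIter (k+1)` (= DEF-1's `QE (univDomains)` at the top level, ✓`B6SectAOperatorsV1.QE_apply`) MINUS the coarse pure gauge `∂Λ_{k+1}` of the hierarchical comb functional;
the weight `ξ⁻¹ = η(k+1)⁻¹ = L^{k+1}` (`Params.eta`) is exactly the dictionary's factor.  Consequently (J-cons′) in its `∀ Y`-form is UNINHABITABLE at `Ψ₀` (the two kernels differ
by the Lie algebra of [15]'s group (4); ◇ lens-1 SELF-AUDIT, nodeO STATUS 12:19:05Z, and DEF-1 12:24:49Z — ◇ re-types it mod gauge), whereas (J-crit′) only reads `curl`s, which are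
BLIND to gradients (✓`curl_dIterL_one`: «`Q(1) = L^{k+1}Q` exactly on plaquette variables») — so (J-crit′)@Ψ₀ is an honest finite identity.  THIS FILE PROVES IT.

WHAT IS PROVED (namespace `…K0AxCtabUniq`).
* §1 (Node00 side, generic `P`, `N`) `fderiv_fderiv_wilsonAction4_expChart_one_self` — `D²(A∘expChart 1)(0)(X,X) = (1∕N)·Σ_p ‖curl 1 X p‖²` (✓`B11Eq177….deriv_deriv_wilsonAction4_expChart_smul_eq`
  + ✓`Node00.deriv_deriv_wilsonAction4_expChart_one_eq_norm_sq`; `LatticeFieldCalculus.curl` HAS Node00's plaquette orientation); ★ `fderiv_fderiv_wilsonAction4_expChart_one_apply` — THE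
  FLAT SECOND VARIATION POLARISED: `D²(A∘expChart 1)(0)(Y,t) = (1∕N)·Σ_p ⟪curl 1 Y p, curl 1 t p⟫_HS` (symmetry of the second derivative of the `C^∞` map ✓`contDiff_wilsonAction4_expChart`,
  `‖a+b‖² = ‖a‖²+2⟪a,b⟫+‖b‖²`) — «∂*∂ in the Abelian case» ([B9] p.392) as a bilinear form; `fderiv_fderiv_wilsonAction4_expChart_one_grad` — pure gauges `∂ν` are null (`curl_grad`).
* §2 (chart side at `Ψ₀`, generic `N`) ★ `fderiv_msChart_flat_atScale_eq_zero_of_qLin_eq_zero` — `qLin (k+1) 1 t = 0 ⟹ DΨ₀(0)t = 0` (✓`fderiv_msChart_apply_eq_suProj_qLin_of_smallBelow` at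
  `U = 1` with ✓`smallBelow_avOfRecord_one`; `atScale (k+1)` constrains level `k+1` only); ★★ `exists_grad_add_mem_ker_fderiv_msChart_flat` — THE COMB-REGAUGED LIFT: a Lie-algebra
  field `Z` with vanishing STRAIGHT mean `Q_{k+1}Z = 0` is regauged by an `𝔰𝔲(N)`-valued site potential INTO `ker DΨ₀(0)` (✓`exists_gauge_dIterL_one_eq_zero_of_bondAvgIter_eq_zero`,
  the block-constant lift of the comb functional, [B7] (62)).
* §3 (DEF-1's side) `inner_dcE_toLp_eq_sum_curl` (`⟪∂x,∂w⟫ = Σ_p (∂x)(p)(∂w)(p)`); ★★ `exists_ker_fderiv_msChart_flat_repr` — for `π = re ∕ im`, an entry `(i,i′)` and `Q_{k+1}w = 0`: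
  `t := 2ξ⁻¹ • (w ⊗ E + ∂ν) ∈ ker DΨ₀(0)` with `⟪dcE 1 (π(ξ⁻¹Y_{ii′})), dcE 1 w⟫ = D²(A∘expChart 1)(0)(Y,t)` for ALL `Y`, `E ∈ 𝔰𝔲(2)` the Hilbert–Schmidt Riesz vector of
  `M ↦ π(M_{ii′})` (orthonormal-basis expansion, `stdOrthonormalBasis`); ★★★ `flatCritDictionary_flatLogChart (k K) : FlatCritDictionary F k K Ψ₀` — (J-crit′)@Ψ₀ DISCHARGED
  (`ker QE(univDomains)` unfolded by PTB-1's ✓`PortU8.QE_windowDomains_eq_zero_iff` at `W = univ`).  The binder `Jcrit` of ✓`rootedReceipts_of_tokens_atScale_flatLogChart` (✓p822476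
  :342), of `…_flatLogChart_onto` ∕ `…_lieExpo` ∕ ★★★★`…_recordScheme` (✓`…K0AxTangentSocketOnto`) is thereby INHABITED; their binder `Jcons` is NOT (uninhabitable as displayed; ◇'s
  FILE 10∕11 re-type it mod gauge).

HONEST.  Finite-dimensional calculus and lattice bookkeeping over the tree's own operators (every input a kernel-checked tree theorem: [B6] Sect. A operators, k0-s1-w1's flat
averaging dictionary, n07-w1∕dag-n10-w1∕dag-n12-w6's chart derivative, n12-w2∕dag-n12-w4's flat second variation, PTB-1's window unfolding); ONE displayed letter of the (R-a) road is
discharged at the concrete chart, nothing else: the KNIT tokens, def-Y's letters, (J-cons″) and ⟨27930⟩ stay displayed; nothing of Bałaban ([15] Thm 1, Prop. 6–9, (176)–(178);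
[B6] (2.35)) is asserted, ported or discharged; (C-tab-opt) stays STRUCK; K0ᴬ stmt-QuantumFields-27238 ∕ K0⁷ 20541 OPEN — NOTHING of them proved; NODE O 0∕1; COUNT 8∕28 · K 1∕4
UNMOVED; finite 𝕋⁴_{L^K} at fixed ε — NOT continuum ∕ OS ∕ Clay; **the Yang–Mills mass gap is NOT proved by any of this.**  No `sorry`, no `def`, no `instance`, no `notation`,
no `set_option`; axioms `[propext, Classical.choice, Quot.sound]`.
-/

noncomputable section

open Filter Topology
open scoped BigOperators Matrix.Norms.L2Operator InnerProductSpace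

namespace Summit.QuantumFields.YangMills.Theorems.K0AxCtabUniq

open Literature.MathematicalPhysics.QuantumFieldTheory.Balaban1983to89
open LatticeFieldCalculus B6SectADomainsV1 B6SectAOperatorsV1
open Literature.MathematicalPhysics.QuantumFieldTheory.Balaban1983to89.T4Continuum (T4Family)
open Literature.MathematicalPhysics.QuantumFieldTheory.Balaban1983to89.Node00
open Literature.MathematicalPhysics.QuantumFieldTheory.Balaban1983to89.B11Eq177CriticalFamilyDerivative
open T4AdjointCovarianceUnitary (lieSU mem_lieSU_iff)
open Literature.MathematicalPhysics.QuantumFieldTheory.BalabanImbrieJaffe1984to88.BIJ85AxialPropagator411 (BondSpace)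
open B15DeterminingSets (DetSet MSField avgFamily atScale bondsOf embIter)
open Summit.QuantumFields.YangMills.Theorems.K0RecordFormatNames
open Summit.QuantumFields.YangMills.Theorems.ChartHInv (bondAvgIter_comp_apply)
open Summit.QuantumFields.YangMills.Theorems.K0Stub1FlatAveragingDictionary (exists_gauge_dIterL_one_eq_zero_of_bondAvgIter_eq_zero)
open Summit.QuantumFields.YangMills.BalabanUVNodes.N12MinimiserFamilyAtRecordBjNoPlaqGuard (fderiv_msChart_apply_eq_suProj_qLin_of_smallBelow)
open Summit.QuantumFields.YangMills.Theorems.PortU8 (QE_windowDomains_eq_zero_iff)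

/-! ## §1  Node00 side: the flat second variation as a BILINEAR form — `D²(A∘expChart 1)(0)(Y, t) = (1∕N)·Σ_p ⟪curl Y p, curl t p⟫` -/

section FlatHessian

variable {P : Params} {j N : ℕ} [NeZero N]

/-- The diagonal of the flat second variation in `curl` letters: `D²(A∘expChart 1)(0)(X, X) = (1∕N)·Σ_p ‖curl 1 X p‖²` (Hilbert–Schmidt norm (17) of `𝔰𝔲(N)`;
✓`deriv_deriv_wilsonAction4_expChart_smul_eq` + ✓`deriv_deriv_wilsonAction4_expChart_one_eq_norm_sq`; `LatticeFieldCalculus.curl` has Node00's plaquette orientation).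
[cite: Balaban1985BackgroundPropagators, (3.10) p.392; Balaban1989LargeFieldII, p.357] -/
theorem fderiv_fderiv_wilsonAction4_expChart_one_self (X : PBond P j → lieSU (Fin N)) :
    fderiv ℝ (fun Y => fderiv ℝ (fun Y : PBond P j → lieSU (Fin N) => wilsonAction4 (expChart (1 : GaugeField P j (SU N)) Y)) Y) 0 X X
      = (∑ p : Plaq P j, ‖curl 1 X p‖ ^ 2) / (Fintype.card (Fin N) : ℝ) := by
  rw [← deriv_deriv_wilsonAction4_expChart_smul_eq, deriv_deriv_wilsonAction4_expChart_one_eq_norm_sq]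
  simp only [curl, one_smul]

/-- ★ **THE FLAT SECOND VARIATION, POLARISED**: `D²(A∘expChart 1)(0)(Y, t) = (1∕N)·Σ_p ⟪curl 1 Y p, curl 1 t p⟫_ℝ` (symmetry of the second derivative of the `C^∞` map
`A∘expChart 1`, ✓`contDiff_wilsonAction4_expChart`, and `‖a+b‖² = ‖a‖² + 2⟪a,b⟫ + ‖b‖²`) — «the operator ∂*∂ in the Abelian case» as a bilinear form.
[cite: Balaban1985BackgroundPropagators, (3.10) p.392; Balaban1984PropagatorsI, (1.65)–(1.66) p.33; Balaban1989LargeFieldII, (1.12) p.359] -/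
theorem fderiv_fderiv_wilsonAction4_expChart_one_apply (Y t : PBond P j → lieSU (Fin N)) :
    fderiv ℝ (fun Y => fderiv ℝ (fun Y : PBond P j → lieSU (Fin N) => wilsonAction4 (expChart (1 : GaugeField P j (SU N)) Y)) Y) 0 Y t
      = (∑ p : Plaq P j, ⟪curl 1 Y p, curl 1 t p⟫_ℝ) / (Fintype.card (Fin N) : ℝ) := by
  set B := fderiv ℝ (fun Y => fderiv ℝ (fun Y : PBond P j → lieSU (Fin N) => wilsonAction4 (expChart (1 : GaugeField P j (SU N)) Y)) Y) 0
    with hB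
  have hsymm : B t Y = B Y t :=
    ((contDiff_wilsonAction4_expChart (1 : GaugeField P j (SU N))).contDiffAt.isSymmSndFDerivAt (by simp)) t Y
  have hpol : B (Y + t) (Y + t) = B Y Y + 2 * B Y t + B t t := by
    simp only [map_add, add_apply, hsymm]
    ring
  have hY := fderiv_fderiv_wilsonAction4_expChart_one_self (P := P) (N := N) Y
  have ht := fderiv_fderiv_wilsonAction4_expChart_one_self (P := P) (N := N) t
  have hYt := fderiv_fderiv_wilsonAction4_expChart_one_self (P := P) (N := N) (Y + t)
  rw [← hB] at hY ht hYt
  have hN : (Fintype.card (Fin N) : ℝ) ≠ 0 := Nat.cast_ne_zero.mpr (Fintype.card_ne_zero)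
  have hcurl : ∀ p : Plaq P j, curl 1 (Y + t) p = curl 1 Y p + curl 1 t p := fun p => curl_add 1 Y t p
  have hsq : ∀ p : Plaq P j, ‖curl 1 (Y + t) p‖ ^ 2 = ‖curl 1 Y p‖ ^ 2 + 2 * ⟪curl 1 Y p, curl 1 t p⟫_ℝ + ‖curl 1 t p‖ ^ 2 := fun p => by
    rw [hcurl, norm_add_sq_real]
  have h2 : 2 * B Y t = (∑ p : Plaq P j, 2 * ⟪curl 1 Y p, curl 1 t p⟫_ℝ) / (Fintype.card (Fin N) : ℝ) := by
    have e : 2 * B Y t = B (Y + t) (Y + t) - B Y Y - B t t := by rw [hpol]; ring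
    rw [e, hYt, hY, ht, ← sub_div, ← sub_div, ← Finset.sum_sub_distrib, ← Finset.sum_sub_distrib]
    congr 1
    exact Finset.sum_congr rfl fun p _ => by rw [hsq]; ring
  rw [← Finset.mul_sum, mul_div_assoc] at h2
  exact mul_left_cancel₀ two_ne_zero h2

/-- Pure gauges are null for the flat second variation (in the second slot): `D²(A∘expChart 1)(0)(Y, ∂ν) = 0` (`curl ∘ grad = 0`).
[cite: Balaban1984PropagatorsI, (1.4) p.18; Balaban1985Variational, (4) p.278] -/
theorem fderiv_fderiv_wilsonAction4_expChart_one_grad (Y : PBond P j → lieSU (Fin N)) (ν : Site P j → lieSU (Fin N)) :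
    fderiv ℝ (fun Y => fderiv ℝ (fun Y : PBond P j → lieSU (Fin N) => wilsonAction4 (expChart (1 : GaugeField P j (SU N)) Y)) Y) 0 Y
      (fun b => ν b.tgt - ν b.src) = 0 := by
  rw [fderiv_fderiv_wilsonAction4_expChart_one_apply]
  have h : ∀ p : Plaq P j, curl 1 (fun b : PBond P j => ν b.tgt - ν b.src) p = 0 := fun p => by
    have e : (fun b : PBond P j => ν b.tgt - ν b.src) = grad 1 ν := by funext b; rw [grad, one_smul]
    rw [e, curl_grad]
  simp only [h, inner_zero_right, Finset.sum_const_zero, zero_div]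

end FlatHessian

/-! ## §2  The chart side at `Ψ₀`: the flat chart kernel contains every Lie-algebra field with `qLin (k+1) 1 = 0`, in particular the COMB-REGAUGED lift of a `ker Q_{k+1}` field -/

section ChartKernel

variable (F : T4Family) {N : ℕ} [NeZero N]

/-- **The flat logarithmic chart's derivative kills the kernel of `qLin (k+1) 1`**: for `Ψ₀ := msChart F N K (k+1) (atScale (k+1)) Ū(1) 1`, `qLin (k+1) 1 t = 0 ⟹ DΨ₀(0) t = 0`
(✓`fderiv_msChart_apply_eq_suProj_qLin_of_smallBelow` at `U = 1` with ✓`smallBelow_avOfRecord_one`; the one-scale determining set `atScale (k+1)` has constrained bonds at level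
`k + 1` only). [cite: Balaban1985Variational, (44)–(48) p.285, (83) p.290; Balaban1988Convergent, (2.10)–(2.13) pp.256–257] -/
theorem fderiv_msChart_flat_atScale_eq_zero_of_qLin_eq_zero (K k : ℕ) (t : PBond (F.P K) 0 → lieSU (Fin N))
    (ht : ∀ c : PBond (F.P K) (k + 1), qLin (k + 1) (1 : GaugeField (F.P K) 0 (SU N)) t c = 0) :
    fderiv ℝ (msChart F N K (k + 1) (atScale (k + 1)) (avgFamily (avOfRecord F N K) 1) (1 : GaugeField (F.P K) 0 (SU N))) 0 t = 0 := by
  funext i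
  rw [fderiv_msChart_apply_eq_suProj_qLin_of_smallBelow (smallBelow_avOfRecord_one F N (k + 1)) (atScale (k + 1)) t i, Pi.zero_apply]
  set s := (constrEnum (atScale (P := F.P K) (k + 1)) (k + 1)).symm i with hs
  have key : ∀ (j' : ℕ) (c : PBond (F.P K) j'), j' = k + 1 → qLin j' (1 : GaugeField (F.P K) 0 (SU N)) t c = 0 := by
    rintro j' c rfl; exact ht c
  by_cases hj : ((s.1 : ℕ)) = k + 1
  · rw [key _ s.2.1 hj, map_zero]
  · exfalso
    have hmem := s.2.2
    simp only [bondsOf, atScale, hj, if_false, Set.mem_setOf_eq, Set.mem_empty_iff_false, or_self] at hmem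

/-- ★ **THE COMB-REGAUGED LIFT**: a Lie-algebra field `Z` in the kernel of the STRAIGHT mean `Q_{k+1}` ([B5] (1.18) = DEF-1's `QE (univDomains)` at the top level) is regauged by an
`𝔰𝔲(N)`-valued site potential `ν` (the block-constant lift of the comb functional, ✓`exists_gauge_dIterL_one_eq_zero_of_bondAvgIter_eq_zero`) INTO THE KERNEL OF `DΨ₀(0)`:
`DΨ₀(0)(Z + ∂ν) = 0`. [cite: Balaban1985Variational, (4) p.278, (44)–(45) p.285; Balaban1985Averaging, (11) p.18, (62) p.28; Balaban1984PropagatorsI, (1.18) p.20] -/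
theorem exists_grad_add_mem_ker_fderiv_msChart_flat (K k : ℕ) (hk : k + 1 ≤ (F.P K).m + (F.P K).K) (Z : PBond (F.P K) 0 → lieSU (Fin N))
    (hZ : ∀ c : PBond (F.P K) (k + 1), bondAvgIter (k + 1) (fun b => (Z b : Matrix (Fin N) (Fin N) ℂ)) c = 0) :
    ∃ ν : Site (F.P K) 0 → lieSU (Fin N),
      fderiv ℝ (msChart F N K (k + 1) (atScale (k + 1)) (avgFamily (avOfRecord F N K) 1) (1 : GaugeField (F.P K) 0 (SU N))) 0
        (fun b => Z b + (ν b.tgt - ν b.src)) = 0 := by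
  have hZs : ∀ b, star ((Z b : lieSU (Fin N)) : Matrix (Fin N) (Fin N) ℂ) = -((Z b : lieSU (Fin N)) : Matrix (Fin N) (Fin N) ℂ) :=
    fun b => (mem_lieSU_iff.1 (Z b).2).1
  obtain ⟨nu, -, -, hker, hsu⟩ := exists_gauge_dIterL_one_eq_zero_of_bondAvgIter_eq_zero (P := F.P K) (k := k + 1) hk hZs hZ
  have hmem : ∀ x, nu x ∈ lieSU (Fin N) := hsu fun b => (Z b).2
  refine ⟨fun x => ⟨nu x, hmem x⟩, fderiv_msChart_flat_atScale_eq_zero_of_qLin_eq_zero F K k _ fun c => ?_⟩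
  rw [qLin_one_apply]
  simp only [Submodule.coe_add, Submodule.coe_sub]
  exact hker c

end ChartKernel

/-! ## §3  DEF-1's side: the K0 quadratic form in `curl` letters, the Riesz vector of an entry functional, and (J-crit′) at `Ψ₀` -/

section Main

variable (F : T4Family)

/-- The K0 test pairing of a real fine-bond function `x` against `w`, in `curl` letters: `⟪∂x, ∂w⟫ = Σ_p (∂x)(p)·(∂w)(p)` (ℓ² pairing of [B6] (2.5)∕(2.8), lattice factor `1`).
[cite: Balaban1984PropagatorsII, (2.5) p.224, (2.8) p.224] -/
theorem inner_dcE_toLp_eq_sum_curl {K : ℕ} (x : PBond (F.P K) 0 → ℝ) (w : BondSpace (F.P K)) :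
    ⟪dcE 1 (WithLp.toLp 2 x), dcE 1 w⟫_ℝ = ∑ p : Plaq (F.P K) 0, curl 1 x p * curl 1 (WithLp.ofLp w) p := by
  rw [inner_eq_sum]
  rfl

/-- ★★ **THE REPRESENTING KERNEL VECTOR.**  `k + 1 ≤ m + K`, `π : ℂ → ℝ` real-linear (`re` or `im`), an entry `(i, i′)`, and `w` with vanishing STRAIGHT mean `Q_{k+1}w = 0`: there is
`t ∈ ker DΨ₀(0)` with `⟪dcE 1 (π(ξ⁻¹·Y_{ii′}))_b, dcE 1 w⟫ = D²(A∘expChart 1)(0)(Y, t)` for EVERY Lie-algebra field `Y` — namely `t := 2ξ⁻¹ • (w ⊗ E + ∂ν)`, `E ∈ 𝔰𝔲(2)` the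
Hilbert–Schmidt Riesz vector of `M ↦ π(M_{ii′})`, `ν` the comb regauging of §2 (null for the flat form, §1). [cite: Balaban1985Variational, (82)–(83) p.290, (37) p.283, (4) p.278;
Balaban1984PropagatorsI, (1.65)–(1.66) p.33, (1.18) p.20; Balaban1985Averaging, (62) p.28] -/
theorem exists_ker_fderiv_msChart_flat_repr (k K : ℕ) (hk : k + 1 ≤ (F.P K).m + (F.P K).K) (π : ℂ →L[ℝ] ℝ) (i i' : Fin 2)
    (w : BondSpace (F.P K)) (hw : ∀ c : PBond (F.P K) (k + 1), bondAvgIter (k + 1) (WithLp.ofLp w) c = 0) :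
    ∃ t : PBond (F.P K) 0 → lieSU (Fin 2),
      fderiv ℝ (msChart F 2 K (k + 1) (atScale (k + 1)) (avgFamily (avOfRecord F 2 K) 1) (1 : GaugeField (F.P K) 0 (SU 2))) 0 t = 0 ∧
      ∀ Y : PBond (F.P K) 0 → lieSU (Fin 2),
        ⟪dcE 1 (WithLp.toLp 2 fun b => π ((((F.P K).eta (k + 1))⁻¹ : ℂ) * ((Y b : lieSU (Fin 2)) : Matrix (Fin 2) (Fin 2) ℂ) i i')), dcE 1 w⟫_ℝ =
          fderiv ℝ (fun Y => fderiv ℝ (fun Y : PBond (F.P K) 0 → lieSU (Fin 2) => wilsonAction4 (expChart (1 : GaugeField (F.P K) 0 (SU 2)) Y)) Y) 0 Y t := by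
  -- the entry functional `ℓ(M) = π(M_{ii′})` on `𝔰𝔲(2)` and its Hilbert–Schmidt Riesz vector `E` (orthonormal-basis expansion; `𝔰𝔲(2)` is finite-dimensional)
  set ℓ : lieSU (Fin 2) →ₗ[ℝ] ℝ :=
    { toFun := fun M => π ((M : Matrix (Fin 2) (Fin 2) ℂ) i i')
      map_add' := fun M M' => by simp only [Submodule.coe_add, Matrix.add_apply, map_add]
      map_smul' := fun r M => by
        simp only [Submodule.coe_smul, Matrix.smul_apply, RingHom.id_apply, map_smul] } with hℓdef
  have hℓ : ∀ M : lieSU (Fin 2), ℓ M = π ((M : Matrix (Fin 2) (Fin 2) ℂ) i i') := fun M => rfl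
  haveI : FiniteDimensional ℝ (Matrix (Fin 2) (Fin 2) ℂ) := inferInstance
  set β := stdOrthonormalBasis ℝ (lieSU (Fin 2)) with hβ
  set E : lieSU (Fin 2) := ∑ r, ℓ (β r) • β r with hEdef
  have hE : ∀ M : lieSU (Fin 2), ⟪E, M⟫_ℝ = π ((M : Matrix (Fin 2) (Fin 2) ℂ) i i') := fun M => by
    rw [← hℓ, hEdef, sum_inner]
    simp only [real_inner_smul_left]
    calc ∑ r, ℓ (β r) * ⟪β r, M⟫_ℝ = ℓ (∑ r, ⟪β r, M⟫_ℝ • β r) := by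
          rw [map_sum]; exact Finset.sum_congr rfl fun r _ => by rw [map_smul, smul_eq_mul, mul_comm]
      _ = ℓ M := by rw [β.sum_repr' M]
  -- the lift `Z := w ⊗ E` has vanishing straight mean
  set Z : PBond (F.P K) 0 → lieSU (Fin 2) := fun b => (WithLp.ofLp w b) • E with hZdef
  have hZ : ∀ c : PBond (F.P K) (k + 1), bondAvgIter (k + 1) (fun b => (Z b : Matrix (Fin 2) (Fin 2) ℂ)) c = 0 := by
    intro c
    have hfun : (fun b => ((Z b : lieSU (Fin 2)) : Matrix (Fin 2) (Fin 2) ℂ)) =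
        fun b => (LinearMap.toSpanSingleton ℝ (Matrix (Fin 2) (Fin 2) ℂ) (E : Matrix (Fin 2) (Fin 2) ℂ)) (WithLp.ofLp w b) := by
      funext b; rw [LinearMap.toSpanSingleton_apply, hZdef, Submodule.coe_smul]
    rw [hfun, bondAvgIter_comp_apply, hw c, map_zero]
  -- comb-regauge it into the chart kernel
  obtain ⟨ν, hν⟩ := exists_grad_add_mem_ker_fderiv_msChart_flat F K k hk Z hZ
  set G : PBond (F.P K) 0 → lieSU (Fin 2) := fun b => ν b.tgt - ν b.src with hGdef
  have ht₀ : (fun b => Z b + (ν b.tgt - ν b.src)) = Z + G := rfl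
  rw [ht₀] at hν
  refine ⟨(2 * ((F.P K).eta (k + 1))⁻¹) • (Z + G), by rw [map_smul, hν, smul_zero], fun Y => ?_⟩
  -- the two sides in `curl` letters
  rw [inner_dcE_toLp_eq_sum_curl, map_smul, smul_eq_mul, map_add]
  rw [show fderiv ℝ (fun Y => fderiv ℝ (fun Y : PBond (F.P K) 0 → lieSU (Fin 2) => wilsonAction4 (expChart (1 : GaugeField (F.P K) 0 (SU 2)) Y)) Y) 0 Y G = 0
      from fderiv_fderiv_wilsonAction4_expChart_one_grad Y ν, add_zero, fderiv_fderiv_wilsonAction4_expChart_one_apply]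
  have hcard : (Fintype.card (Fin 2) : ℝ) = 2 := by simp
  have hcurlZ : ∀ p : Plaq (F.P K) 0, curl 1 Z p = (curl 1 (WithLp.ofLp w) p) • E := fun p => by
    simp only [curl, one_smul, hZdef, add_smul, sub_smul]
  have hcurlY : ∀ p : Plaq (F.P K) 0,
      curl 1 (fun b => π ((((F.P K).eta (k + 1))⁻¹ : ℂ) * ((Y b : lieSU (Fin 2)) : Matrix (Fin 2) (Fin 2) ℂ) i i')) p =
        ((F.P K).eta (k + 1))⁻¹ * π (((curl 1 Y p : lieSU (Fin 2)) : Matrix (Fin 2) (Fin 2) ℂ) i i') := fun p => by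
    have hmul : ∀ z : ℂ, π ((((F.P K).eta (k + 1))⁻¹ : ℂ) * z) = ((F.P K).eta (k + 1))⁻¹ * π z := fun z => by
      rw [← Complex.ofReal_inv, ← Complex.real_smul, map_smul, smul_eq_mul]
    simp only [curl, one_smul, hmul, Submodule.coe_add, Submodule.coe_sub, Matrix.add_apply, Matrix.sub_apply, map_add, map_sub]
    ring
  have hE' : ∀ M : lieSU (Fin 2), ⟪M, E⟫_ℝ = π ((M : Matrix (Fin 2) (Fin 2) ℂ) i i') := fun M => by rw [real_inner_comm]; exact hE M
  simp only [hcurlZ, hcurlY, real_inner_smul_right, hE', hcard]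
  have h2 : ∀ a S : ℝ, 2 * a * (S / 2) = a * S := fun a S => by ring
  rw [h2, Finset.mul_sum]
  exact Finset.sum_congr rfl fun p _ => by ring

/-- ★★★ **(J-crit′) AT THE CANONICAL FLAT LOGARITHMIC CHART IS TRUE** — `FlatCritDictionary F k K Ψ₀`, `Ψ₀ := msChart F 2 K (k+1) (atScale (k+1)) Ū(1) 1`, DISCHARGED: every K0 test pairing
`⟪dcE 1 (ξ⁻¹·re∕im Y_{ii′}), dcE 1 w⟫`, `w ∈ ker QE(univDomains)`, IS `D²(A∘expChart 1)(0)(Y, t)` for a `t ∈ ker DΨ₀(0)` (the comb-regauged lift of `w ⊗ E_{ii′}`).  The displayed letter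
`Jcrit` of ✓`rootedReceipts_of_tokens_atScale_flatLogChart[_onto]` ∕ ✓`rootedReceipts_of_tokens_atScale_recordScheme` is thereby inhabited (ZERO letters left on the
criticality half of the (R-a) road's flat dictionaries; the (J-cons′) half is uninhabitable in its ∀-form and is being re-typed mod gauge — ◇ lens-1 FILE 10∕11).  Pure tree:
[B6] Sect. A operators, k0-s1-w1's flat averaging dictionary, n07-w1∕dag-n10-w1's chart derivative, n12-w2's flat second variation. [cite: Balaban1985Variational, (82)–(83) p.290,
(36)–(37) p.283, (176)–(178) p.306; Balaban1984PropagatorsI, (1.65)–(1.66) p.33; Balaban1984PropagatorsII, (2.5)–(2.8) p.224, (2.35) p.228] -/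
theorem flatCritDictionary_flatLogChart (k K : ℕ) :
    FlatCritDictionary F k K (msChart F 2 K (k + 1) (atScale (k + 1)) (avgFamily (avOfRecord F 2 K) 1) (1 : GaugeField (F.P K) 0 (SU 2))) := by
  intro hk i i' w hw
  have hw' : ∀ c : PBond (F.P K) (k + 1), bondAvgIter (k + 1) (WithLp.ofLp w) c = 0 := fun c =>
    ((QE_windowDomains_eq_zero_iff F hk Finset.univ w).1 hw).2 c (Or.inl (Finset.mem_univ _))
  obtain ⟨t₁, ht₁, h₁⟩ := exists_ker_fderiv_msChart_flat_repr F k K hk Complex.reCLM i i' w hw'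
  obtain ⟨t₂, ht₂, h₂⟩ := exists_ker_fderiv_msChart_flat_repr F k K hk Complex.imCLM i i' w hw'
  exact ⟨⟨t₁, ht₁, fun Y => h₁ Y⟩, ⟨t₂, ht₂, fun Y => h₂ Y⟩⟩

end Main

end Summit.QuantumFields.YangMills.Theorems.K0AxCtabUniq

end
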